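import Mathlib
import Summits.KontsevichZagierPeriods.KontsevichZagierPeriods.Theorems.SoloInformedDivisionTorsion
import Literature.NumberTheory.Transcendental.KZBetaChains
import Literature.NumberTheory.Transcendental.SemialgebraicAlgebraicPoints
import HarnessLib
import HarnessLib.Audit

/-!
# Division by translation XIV: division chains exist at every order (solo-informed, s44)

Parts I–VII (s43) proved LEMMA XXIX.1 and THEOREM XXIX (i)–(iii) in KERNEL form *given* a
division chain `c : SoloInformedDivChain m q` (abscissae `s_0 = 0 < s_1 ≤ … ≤ s_q = 1`,
`s_{j+1} = T_{s_j}(s_1)`, turn conditions `s_1²(1 − m s_j²) ≤ 1 − s_j²`), and chains were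
exhibited at orders `2` (every modulus, part XIII) and `3` (one-parameter family, part VIII).
This file constructs a chain of EVERY order `q ≥ 1` for EVERY real algebraic `0 < m < 1`, with
no elliptic functions: THEOREM XXIX's kernel form is unconditional and non-vacuous at every
torsion order and every algebraic modulus.

Construction (a first-exit principle).  Let `S_0(a) = 0`, `S_{j+1}(a) = T_{S_j(a)}(a)` be the
iterated translates of the origin by the step `a ∈ [0,1]` (`soloInformedIter`; model
`S_j(sn u) = sn(ju)` while the arc stays in the quarter period) and
`φ_j(a) = (1 − S_j(a)²) − a²(1 − m S_j(a)²)` the TURN MARGINS (`soloInformedMargin`).  The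
`S_j`, `φ_j` are continuous on `[0,1]` and `ℚ`-semialgebraic (sums, products, square roots and
non-vanishing quotients of semialgebraic functions; `m` algebraic).  Let

  `A = ⋃_{j<q} {a ∈ [0,1] : φ_j(a) ≤ 0}` (closed, `1 ∈ A` by `φ_0(1) = 0`, `0 ∉ A`),
  `b = inf A` (`soloInformedDivStep m q`; model: `b = sn(K(m)/q | m)`).

Then (1) `0 < b ≤ 1`; (2) `φ_j > 0` on `[0,b)` for all `j < q`, hence `φ_j(b) ≥ 0` (closedness):
the TURN CONDITIONS hold at `b`; (3) `b ∈ A`, so some `φ_{j₀}(b) = 0`, `j₀ < q`; (4) EQUALITY in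
the turn condition forces the top — `a²(1 − m s²) = 1 − s²` gives
`(c_s c_a)² = (s a d_s d_a)²`, so `cn = 0` in Jacobi's addition theorem and `T_s(a) = 1`
(`soloInformed_addm_eq_one_of_margin`) — whence `S_{j₀+1}(b) = 1`; (5) if `j₀ + 1 < q` then
`φ_{j₀+1}(b) = −b²(1 − m) < 0` contradicts (2), so `j₀ + 1 = q` and `S_q(b) = 1`; (6) `b` is
ALGEBRAIC: `A' = {x ∈ ℝ¹ : x₀ ∈ A}` is `ℚ`-semialgebraic (graph elimination) and is not a
neighbourhood of its point `(b)` (points just below `b` are not in `A`), and non-interior points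
of `ℚ`-semialgebraic subsets of the line are algebraic (`isAlgebraic_of_mem_of_not_mem_nhds`).
Hence `(S_j(b))_{j ≤ q}` is a division chain of order `q` (`soloInformedDivChainOf`,
`soloInformed_nonempty_divChain`), and THEOREM XXIX(i) holds hypothesis-free at every order
(`soloInformed_division_thirdKind_value`: `Π(m s_p² | m) = λ·K(m)`, `λ` explicit algebraic).

References: C. G. J. Jacobi, *Fundamenta nova* (1829), §18, §§20–21 (division of `F`);
N. H. Abel, *Recherches sur les fonctions elliptiques* (1827–28), §§9–10; J. Bochnak, M. Coste,
M.-F. Roy, *Real algebraic geometry* (1998), §2.2, Prop. 2.2.6; M. Kontsevich, D. Zagier,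
*Periods* (2001), §1.1–1.2; this work (solo-informed s43–s44).
-/

noncomputable section

open Set Filter Topology
open scoped Classical

open Literature.NumberTheory.Transcendental Literature.NumberTheory.Transcendental.KZ
open Literature.ModelTheory.ExponentialFields

namespace Summit.KontsevichZagierPeriods.KontsevichZagierPeriods.Theorems

/-! ### Iterated translates of the origin -/

/-- `S_0(a) = 0`, `S_{j+1}(a) = T_{S_j(a)}(a)`: the `j`-th translate of the origin by the step `a`
under Jacobi's addition map (model: `S_j(sn u) = sn(j u)` inside the quarter period).
[Jacobi 1829, §18] -/
def soloInformedIter (m a : ℝ) : ℕ → ℝ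
  | 0 => 0
  | j + 1 => soloInformedAddm m (soloInformedIter m a j) a

/-- `S_0 = 0`. [this work] -/
theorem soloInformed_iter_zero (m a : ℝ) : soloInformedIter m a 0 = 0 := rfl

/-- `S_{j+1}(a) = T_{S_j(a)}(a)`. [this work] -/
theorem soloInformed_iter_succ (m a : ℝ) (j : ℕ) :
    soloInformedIter m a (j + 1) = soloInformedAddm m (soloInformedIter m a j) a := rfl

/-- `S_1(a) = a` (`T_0 = id`). [this work] -/
theorem soloInformed_iter_one (m a : ℝ) : soloInformedIter m a 1 = a := by
  rw [soloInformed_iter_succ, soloInformed_iter_zero, soloInformed_addm_origin]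

/-- All iterates stay in `[0,1]` for a step `a ∈ [0,1]`. [this work] -/
theorem soloInformed_iter_mem {m a : ℝ} (hm : m ∈ Ioo (0:ℝ) 1) (ha : a ∈ Icc (0:ℝ) 1) :
    ∀ j : ℕ, soloInformedIter m a j ∈ Icc (0:ℝ) 1
  | 0 => ⟨le_rfl, zero_le_one⟩
  | j + 1 => ⟨soloInformed_addm_nonneg hm (soloInformed_iter_mem hm ha j) ha,
      (soloInformed_addm_lt_one hm (soloInformed_iter_mem hm ha j) ha).1⟩

/-- With step `0` nothing moves: `S_j(0) = 0`. [this work] -/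
theorem soloInformed_iter_at_zero (m : ℝ) : ∀ j : ℕ, soloInformedIter m 0 j = 0
  | 0 => rfl
  | j + 1 => by rw [soloInformed_iter_succ, soloInformed_iter_at_zero m j, soloInformed_addm_origin]

/-- The iterates are continuous in the step on `[0,1]`. [folklore] -/
theorem soloInformed_iter_continuousOn {m : ℝ} (hm : m ∈ Ioo (0:ℝ) 1) :
    ∀ j : ℕ, ContinuousOn (fun a => soloInformedIter m a j) (Icc (0:ℝ) 1)
  | 0 => continuousOn_const
  | j + 1 => by
    have ih := soloInformed_iter_continuousOn hm j
    have hw : Continuous fun a : ℝ => √(1 - a ^ 2) * √(1 - m * a ^ 2) := by fun_prop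
    have hN : ContinuousOn (fun a => a * (√(1 - soloInformedIter m a j ^ 2) *
        √(1 - m * soloInformedIter m a j ^ 2)) +
        soloInformedIter m a j * (√(1 - a ^ 2) * √(1 - m * a ^ 2))) (Icc (0:ℝ) 1) :=
      (continuousOn_id.mul ((continuousOn_const.sub (ih.pow 2)).sqrt.mul
        (continuousOn_const.sub (continuousOn_const.mul (ih.pow 2))).sqrt)).add
        (ih.mul hw.continuousOn)
    have hD : ContinuousOn (fun a => 1 - m * soloInformedIter m a j ^ 2 * a ^ 2) (Icc (0:ℝ) 1) :=
      continuousOn_const.sub ((continuousOn_const.mul (ih.pow 2)).mul (continuousOn_id.pow 2))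
    simp only [soloInformed_iter_succ, soloInformedAddm]
    exact hN.div hD fun a ha => (soloInformed_addm_denom_pos hm (soloInformed_iter_mem hm ha j) ha).ne'

/-- **The iterates are `ℚ`-semialgebraic functions of the step** on `[0,1] ⊆ ℝ¹` (`m` algebraic):
sums, products, square roots and a non-vanishing quotient of semialgebraic functions, by
induction on `j`. [BCR 1998, Prop. 2.2.6] -/
theorem soloInformed_iter_sa {m : ℝ} (hm : m ∈ Ioo (0:ℝ) 1) (hma : IsAlgebraic ℚ m) :
    ∀ j : ℕ, IsSemialgebraicFunOn ℚ {x : Fin 1 → ℝ | x 0 ∈ Icc (0:ℝ) 1}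
      (fun x => soloInformedIter m (x 0) j)
  | 0 => by
    simpa only [soloInformed_iter_zero] using
      isSemialgebraicFunOn_const_of_isAlgebraic isSemialgebraic_setOf_apply_mem_Icc isAlgebraic_zero
  | j + 1 => by
    have hS := isSemialgebraic_setOf_apply_mem_Icc
    have ih := soloInformed_iter_sa hm hma j
    obtain ⟨h1, h2, -⟩ := soloInformed_addm_pieces_sa hma isAlgebraic_zero hS
    have hX : IsSemialgebraicFunOn ℚ {x : Fin 1 → ℝ | x 0 ∈ Icc (0:ℝ) 1} (fun x => x 0) :=
      (isSemialgebraicFunOn_aeval hS (MvPolynomial.X 0)).congr fun x _ => by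
        simp only [MvPolynomial.aeval_X]
    have hone := isSemialgebraicFunOn_const_of_isAlgebraic hS isAlgebraic_one
    have hmc := isSemialgebraicFunOn_const_of_isAlgebraic hS hma
    have hI2 := ih.mul_holds ih
    have h3 : IsSemialgebraicFunOn ℚ {x : Fin 1 → ℝ | x 0 ∈ Icc (0:ℝ) 1}
        (fun x => 1 - soloInformedIter m (x 0) j ^ 2) :=
      (hone.sub_holds hI2).congr fun x _ => by simp only [Pi.sub_apply, Pi.mul_apply]; ring
    have h4 : IsSemialgebraicFunOn ℚ {x : Fin 1 → ℝ | x 0 ∈ Icc (0:ℝ) 1}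
        (fun x => 1 - m * soloInformedIter m (x 0) j ^ 2) :=
      (hone.sub_holds (hmc.mul_holds hI2)).congr fun x _ => by
        simp only [Pi.sub_apply, Pi.mul_apply]; ring
    have h5 : IsSemialgebraicFunOn ℚ {x : Fin 1 → ℝ | x 0 ∈ Icc (0:ℝ) 1}
        (fun x => 1 - m * soloInformedIter m (x 0) j ^ 2 * x 0 ^ 2) :=
      (hone.sub_holds ((hmc.mul_holds hI2).mul_holds (hX.mul_holds hX))).congr fun x _ => by
        simp only [Pi.sub_apply, Pi.mul_apply]; ring
    refine (((hX.mul_holds ((IsSemialgebraicFunOn.sqrt_holds h3).mul_holds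
      (IsSemialgebraicFunOn.sqrt_holds h4))).add_holds (ih.mul_holds
      ((IsSemialgebraicFunOn.sqrt_holds h1).mul_holds (IsSemialgebraicFunOn.sqrt_holds h2)))).div
      h5 fun x hx => (soloInformed_addm_denom_pos hm (soloInformed_iter_mem hm hx j) hx).ne').congr
      fun x _ => ?_
    simp only [Pi.add_apply, Pi.mul_apply, soloInformed_iter_succ, soloInformedAddm]

/-! ### Turn margins -/

/-- The TURN MARGIN `φ_j(a) = (1 − S_j(a)²) − a²(1 − m S_j(a)²)`: the turn condition of a
division chain at the node `j` is `φ_j ≥ 0` (model: `(j+1)u ≤ K` for `a = sn u`). [this work] -/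
def soloInformedMargin (m a : ℝ) (j : ℕ) : ℝ :=
  (1 - soloInformedIter m a j ^ 2) - a ^ 2 * (1 - m * soloInformedIter m a j ^ 2)

/-- `φ_j(0) = 1`. [this work] -/
theorem soloInformed_margin_at_zero (m : ℝ) (j : ℕ) : soloInformedMargin m 0 j = 1 := by
  rw [soloInformedMargin, soloInformed_iter_at_zero]; ring

/-- `φ_0(a) = 1 − a²`; in particular `φ_0(1) = 0`. [this work] -/
theorem soloInformed_margin_zero (m a : ℝ) : soloInformedMargin m a 0 = 1 - a ^ 2 := by
  rw [soloInformedMargin, soloInformed_iter_zero]; ring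

/-- At the top the margin is negative: `S_j(a) = 1 ⟹ φ_j(a) = −a²(1 − m)`. [this work] -/
theorem soloInformed_margin_of_top {m a : ℝ} {j : ℕ} (h : soloInformedIter m a j = 1) :
    soloInformedMargin m a j = -(a ^ 2 * (1 - m)) := by
  rw [soloInformedMargin, h]; ring

/-- The margins are continuous in the step on `[0,1]`. [folklore] -/
theorem soloInformed_margin_continuousOn {m : ℝ} (hm : m ∈ Ioo (0:ℝ) 1) (j : ℕ) :
    ContinuousOn (fun a => soloInformedMargin m a j) (Icc (0:ℝ) 1) := by
  have ih := soloInformed_iter_continuousOn hm j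
  simp only [soloInformedMargin]
  exact (continuousOn_const.sub (ih.pow 2)).sub
    ((continuousOn_id.pow 2).mul (continuousOn_const.sub (continuousOn_const.mul (ih.pow 2))))

/-- The reversed margin `a²(1 − m S_j²) − (1 − S_j²)` is a `ℚ`-semialgebraic function of the step.
[BCR 1998, Prop. 2.2.6] -/
theorem soloInformed_margin_sa {m : ℝ} (hm : m ∈ Ioo (0:ℝ) 1) (hma : IsAlgebraic ℚ m) (j : ℕ) :
    IsSemialgebraicFunOn ℚ {x : Fin 1 → ℝ | x 0 ∈ Icc (0:ℝ) 1}
      (fun x => x 0 ^ 2 * (1 - m * soloInformedIter m (x 0) j ^ 2) -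
        (1 - soloInformedIter m (x 0) j ^ 2)) := by
  have hS := isSemialgebraic_setOf_apply_mem_Icc
  have ih := soloInformed_iter_sa hm hma j
  have hX : IsSemialgebraicFunOn ℚ {x : Fin 1 → ℝ | x 0 ∈ Icc (0:ℝ) 1} (fun x => x 0) :=
    (isSemialgebraicFunOn_aeval hS (MvPolynomial.X 0)).congr fun x _ => by
      simp only [MvPolynomial.aeval_X]
  have hone := isSemialgebraicFunOn_const_of_isAlgebraic hS isAlgebraic_one
  have hmc := isSemialgebraicFunOn_const_of_isAlgebraic hS hma
  have hI2 := ih.mul_holds ih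
  exact (((hX.mul_holds hX).mul_holds (hone.sub_holds (hmc.mul_holds hI2))).sub_holds
    (hone.sub_holds hI2)).congr fun x _ => by simp only [Pi.sub_apply, Pi.mul_apply]; ring

/-- **Equality in the turn condition forces the top.** For `s, a ∈ [0,1]`:
`a²(1 − m s²) = 1 − s² ⟹ T_s(a) = 1` (then `(c_s c_a)² = (s a d_s d_a)²`, so the `cn`-numerator
of the addition theorem vanishes). [Jacobi 1829, §18; this work] -/
theorem soloInformed_addm_eq_one_of_margin {m s a : ℝ} (hm : m ∈ Ioo (0:ℝ) 1)
    (hs : s ∈ Icc (0:ℝ) 1) (ha : a ∈ Icc (0:ℝ) 1) (h : a ^ 2 * (1 - m * s ^ 2) = 1 - s ^ 2) :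
    soloInformedAddm m s a = 1 := by
  obtain ⟨hcs, hds⟩ := soloInformed_addm_radicands hm hs
  obtain ⟨hca, hda⟩ := soloInformed_addm_radicands hm ha
  have hD := soloInformed_addm_denom_pos hm hs ha
  have hT0 := soloInformed_addm_nonneg hm hs ha
  set P : ℝ := √(1 - s ^ 2) * √(1 - a ^ 2) with hP
  set Q : ℝ := s * a * (√(1 - m * s ^ 2) * √(1 - m * a ^ 2)) with hQ
  have hP0 : 0 ≤ P := mul_nonneg (Real.sqrt_nonneg _) (Real.sqrt_nonneg _)
  have hQ0 : 0 ≤ Q :=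
    mul_nonneg (mul_nonneg hs.1 ha.1) (mul_nonneg (Real.sqrt_nonneg _) (Real.sqrt_nonneg _))
  have hP2 : P ^ 2 = (1 - s ^ 2) * (1 - a ^ 2) := by
    rw [hP, mul_pow, Real.sq_sqrt hcs, Real.sq_sqrt hca]
  have hQ2 : Q ^ 2 = s ^ 2 * a ^ 2 * ((1 - m * s ^ 2) * (1 - m * a ^ 2)) := by
    rw [hQ, mul_pow, mul_pow, mul_pow, Real.sq_sqrt hds.le, Real.sq_sqrt hda.le]
  have hPQ : P = Q := (sq_eq_sq₀ hP0 hQ0).1 (by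
    linear_combination hP2 - hQ2 + (-(1 - m * s ^ 2 * a ^ 2)) * h)
  have hsq : (1 - m * s ^ 2 * a ^ 2) ^ 2 * (1 - soloInformedAddm m s a ^ 2) = (P - Q) ^ 2 :=
    soloInformed_addm_one_sub_sq hm hs ha
  rw [hPQ, sub_self, zero_pow two_ne_zero, mul_eq_zero] at hsq
  have h1 : soloInformedAddm m s a ^ 2 = 1 := by
    rcases hsq with h0 | h0
    · exact absurd h0 (pow_ne_zero 2 hD.ne')
    · linarith
  exact (pow_eq_one_iff_of_nonneg hT0 two_ne_zero).1 h1

/-! ### The first-exit step and the division chain -/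

/-- The FIRST-EXIT SET `A = ⋃_{j<q} {a ∈ [0,1] : φ_j(a) ≤ 0}`: steps at which some turn among the
first `q` nodes fails (weakly). [this work] -/
def soloInformedFailSet (m : ℝ) (q : ℕ) : Set ℝ :=
  ⋃ j ∈ Finset.range q, {a | a ∈ Icc (0:ℝ) 1 ∧ soloInformedMargin m a j ≤ 0}

/-- The `q`-DIVISION STEP `b = inf A` (model: `b = sn(K(m)/q | m)`), defined without elliptic
functions. [this work] -/
def soloInformedDivStep (m : ℝ) (q : ℕ) : ℝ := sInf (soloInformedFailSet m q)

/-- Unfolding membership in the first-exit set. [this work] -/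
theorem soloInformed_mem_failSet {m a : ℝ} {q : ℕ} : a ∈ soloInformedFailSet m q ↔
    ∃ j, j < q ∧ a ∈ Icc (0:ℝ) 1 ∧ soloInformedMargin m a j ≤ 0 := by
  simp only [soloInformedFailSet, mem_iUnion, mem_setOf_eq, exists_prop, Finset.mem_range]

/-- `A ⊆ [0,1]`, `1 ∈ A` (for `q ≥ 1`, by `φ_0(1) = 0`), `0 ∉ A` (`φ_j(0) = 1`), `A` closed.
[this work] -/
theorem soloInformed_failSet_facts {m : ℝ} (hm : m ∈ Ioo (0:ℝ) 1) {q : ℕ} (hq : 1 ≤ q) :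
    soloInformedFailSet m q ⊆ Icc (0:ℝ) 1 ∧ (1:ℝ) ∈ soloInformedFailSet m q ∧
      (0:ℝ) ∉ soloInformedFailSet m q ∧ IsClosed (soloInformedFailSet m q) := by
  refine ⟨fun a ha => ?_, ?_, fun h0 => ?_, ?_⟩
  · obtain ⟨j, -, hj, -⟩ := soloInformed_mem_failSet.1 ha; exact hj
  · exact soloInformed_mem_failSet.2 ⟨0, hq, ⟨zero_le_one, le_rfl⟩,
      by rw [soloInformed_margin_zero]; norm_num⟩
  · obtain ⟨j, -, -, hj⟩ := soloInformed_mem_failSet.1 h0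
    rw [soloInformed_margin_at_zero] at hj
    exact absurd hj (by norm_num)
  · exact isClosed_biUnion_finset fun j _ =>
      (soloInformed_margin_continuousOn hm j).preimage_isClosed_of_isClosed isClosed_Icc isClosed_Iic

/-- **The division step.** For `q ≥ 1`: `0 < b ≤ 1`, `b ∈ A`, the turn margins are positive on
`[0,b)` and non-negative at `b` for all `j < q`. [this work] -/
theorem soloInformed_divStep_spec {m : ℝ} (hm : m ∈ Ioo (0:ℝ) 1) {q : ℕ} (hq : 1 ≤ q) :
    soloInformedDivStep m q ∈ Ioc (0:ℝ) 1 ∧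
      soloInformedDivStep m q ∈ soloInformedFailSet m q ∧
      (∀ a ∈ Ico (0:ℝ) (soloInformedDivStep m q), ∀ j < q, 0 < soloInformedMargin m a j) ∧
      ∀ j < q, 0 ≤ soloInformedMargin m (soloInformedDivStep m q) j := by
  obtain ⟨hAsub, h1A, h0A, hAcl⟩ := soloInformed_failSet_facts hm hq
  have hbdd : BddBelow (soloInformedFailSet m q) := ⟨0, fun a ha => (hAsub ha).1⟩
  have hbA : soloInformedDivStep m q ∈ soloInformedFailSet m q := hAcl.csInf_mem ⟨1, h1A⟩ hbdd
  have hb1 : soloInformedDivStep m q ∈ Icc (0:ℝ) 1 := hAsub hbA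
  have hb0 : 0 < soloInformedDivStep m q := by
    rcases hb1.1.lt_or_eq with h | h
    · exact h
    · exact absurd (h ▸ hbA : (0:ℝ) ∈ soloInformedFailSet m q) h0A
  have hpos : ∀ a ∈ Ico (0:ℝ) (soloInformedDivStep m q), ∀ j < q,
      0 < soloInformedMargin m a j := by
    intro a ha j hj
    by_contra hle
    exact notMem_of_lt_csInf ha.2 hbdd
      (soloInformed_mem_failSet.2 ⟨j, hj, ⟨ha.1, ha.2.le.trans hb1.2⟩, not_lt.1 hle⟩)
  refine ⟨⟨hb0, hb1.2⟩, hbA, hpos, fun j hj => ?_⟩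
  have hB : IsClosed (Icc (0:ℝ) 1 ∩ (fun a => soloInformedMargin m a j) ⁻¹' Ici 0) :=
    (soloInformed_margin_continuousOn hm j).preimage_isClosed_of_isClosed isClosed_Icc isClosed_Ici
  have hsub : Ico (0:ℝ) (soloInformedDivStep m q) ⊆
      Icc (0:ℝ) 1 ∩ (fun a => soloInformedMargin m a j) ⁻¹' Ici 0 :=
    fun a ha => ⟨⟨ha.1, ha.2.le.trans hb1.2⟩, (hpos a ha j hj).le⟩
  have hmem : soloInformedDivStep m q ∈ closure (Ico (0:ℝ) (soloInformedDivStep m q)) := by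
    rw [closure_Ico hb0.ne]; exact right_mem_Icc.2 hb0.le
  exact (hB.closure_subset_iff.2 hsub hmem).2

/-- **The top is reached exactly at the last node: `S_q(b) = 1`.** Some margin vanishes at
`b ∈ A`; equality in the turn condition forces the next iterate to be `1`; a node equal to `1`
before the last would make the next margin `−b²(1−m) < 0`. [this work] -/
theorem soloInformed_iter_divStep_top {m : ℝ} (hm : m ∈ Ioo (0:ℝ) 1) {q : ℕ} (hq : 1 ≤ q) :
    soloInformedIter m (soloInformedDivStep m q) q = 1 := by
  obtain ⟨hb, hbA, -, hturn⟩ := soloInformed_divStep_spec hm hq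
  have hb1 : soloInformedDivStep m q ∈ Icc (0:ℝ) 1 := ⟨hb.1.le, hb.2⟩
  obtain ⟨j₀, hj₀q, -, hle⟩ := soloInformed_mem_failSet.1 hbA
  have hj₀ : soloInformedMargin m (soloInformedDivStep m q) j₀ = 0 := le_antisymm hle (hturn j₀ hj₀q)
  have htop : soloInformedIter m (soloInformedDivStep m q) (j₀ + 1) = 1 := by
    rw [soloInformed_iter_succ]
    refine soloInformed_addm_eq_one_of_margin hm (soloInformed_iter_mem hm hb1 j₀) hb1 ?_
    unfold soloInformedMargin at hj₀
    linarith
  have hjq : j₀ + 1 = q := by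
    by_contra hne
    have h := hturn (j₀ + 1) (by omega)
    rw [soloInformed_margin_of_top htop] at h
    nlinarith [hm.2, hb.1, mul_pos (pow_pos hb.1 2) (sub_pos.2 hm.2)]
  rw [hjq] at htop; exact htop

/-- **The division step is algebraic** (`m` algebraic): `{x ∈ ℝ¹ : x₀ ∈ A}` is `ℚ`-semialgebraic
and is not a neighbourhood of its point `(b)` (no point just below `b = inf A` lies in `A`);
non-interior points of `ℚ`-semialgebraic subsets of the line are algebraic.
[BCR 1998, §2.2; this work] -/
theorem soloInformed_divStep_isAlgebraic {m : ℝ} (hm : m ∈ Ioo (0:ℝ) 1) (hma : IsAlgebraic ℚ m)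
    {q : ℕ} (hq : 1 ≤ q) : IsAlgebraic ℚ (soloInformedDivStep m q) := by
  obtain ⟨hAsub, -, -, -⟩ := soloInformed_failSet_facts hm hq
  obtain ⟨-, hbA, -, -⟩ := soloInformed_divStep_spec hm hq
  have hbdd : BddBelow (soloInformedFailSet m q) := ⟨0, fun a ha => (hAsub ha).1⟩
  have hAsa : IsSemialgebraic ℚ {x : Fin 1 → ℝ | x 0 ∈ soloInformedFailSet m q} := by
    have e : {x : Fin 1 → ℝ | x 0 ∈ soloInformedFailSet m q} = ⋃ j ∈ Finset.range q,
        {x | x ∈ {x : Fin 1 → ℝ | x 0 ∈ Icc (0:ℝ) 1} ∧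
          0 ≤ x 0 ^ 2 * (1 - m * soloInformedIter m (x 0) j ^ 2) -
            (1 - soloInformedIter m (x 0) j ^ 2)} := by
      ext x
      simp only [soloInformedFailSet, soloInformedMargin, mem_iUnion, mem_setOf_eq, exists_prop,
        sub_nonpos, sub_nonneg]
    rw [e]
    exact IsSemialgebraic.biUnion _ _ fun j _ => (soloInformed_margin_sa hm hma j).isSemialgebraic_sep_nonneg
  have hnot : {x : Fin 1 → ℝ | x 0 ∈ soloInformedFailSet m q} ∉ 𝓝 (fun _ : Fin 1 =>
      soloInformedDivStep m q) := by
    intro hN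
    have hc : Continuous fun t : ℝ => (fun _ : Fin 1 => t) := continuous_pi fun _ => continuous_id
    have hN' : soloInformedFailSet m q ∈ 𝓝 (soloInformedDivStep m q) := by
      simpa using hc.continuousAt.preimage_mem_nhds hN
    obtain ⟨l, u, ⟨hl, hu⟩, hsub⟩ := mem_nhds_iff_exists_Ioo_subset.1 hN'
    exact notMem_of_lt_csInf (by linarith : (l + soloInformedDivStep m q) / 2 <
      soloInformedDivStep m q) hbdd (hsub ⟨by linarith, by linarith⟩)
  exact isAlgebraic_of_mem_of_not_mem_nhds (x := fun _ : Fin 1 => soloInformedDivStep m q)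
    hAsa hbA hnot

/-- **A DIVISION CHAIN OF EVERY ORDER `q ≥ 1` FOR EVERY REAL ALGEBRAIC `0 < m < 1`**:
`s_j = S_j(b)`, `b` the `q`-division step (model `s_j = sn(jK/q | m)`).  THEOREM XXIX's kernel
form (parts III–VII, IX, X) is thereby unconditional at every torsion order. [this work] -/
def soloInformedDivChainOf {m : ℝ} (hm : m ∈ Ioo (0:ℝ) 1) (hma : IsAlgebraic ℚ m) {q : ℕ}
    (hq : 1 ≤ q) : SoloInformedDivChain m q where
  s := soloInformedIter m (soloInformedDivStep m q)
  s_zero := rfl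
  one_pos := by rw [soloInformed_iter_one]; exact (soloInformed_divStep_spec hm hq).1.1
  one_le := by rw [soloInformed_iter_one]; exact (soloInformed_divStep_spec hm hq).1.2
  one_isAlgebraic := by
    rw [soloInformed_iter_one]; exact soloInformed_divStep_isAlgebraic hm hma hq
  step j _ := by rw [soloInformed_iter_one]; rfl
  turn j hj := by
    rw [soloInformed_iter_one]
    have h := (soloInformed_divStep_spec hm hq).2.2.2 j hj
    unfold soloInformedMargin at h
    linarith
  top := soloInformed_iter_divStep_top hm hq

/-- The abscissae of the constructed chain are the iterates at the division step. [this work] -/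
theorem soloInformed_divChainOf_s {m : ℝ} (hm : m ∈ Ioo (0:ℝ) 1) (hma : IsAlgebraic ℚ m)
    {q : ℕ} (hq : 1 ≤ q) (j : ℕ) :
    (soloInformedDivChainOf hm hma hq).s j = soloInformedIter m (soloInformedDivStep m q) j := rfl

/-- **Division chains exist at every order `q ≥ 1` for every real algebraic modulus.**
[this work] -/
theorem soloInformed_nonempty_divChain {m : ℝ} (hm : m ∈ Ioo (0:ℝ) 1) (hma : IsAlgebraic ℚ m)
    {q : ℕ} (hq : 1 ≤ q) : Nonempty (SoloInformedDivChain m q) :=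
  ⟨soloInformedDivChainOf hm hma hq⟩

/-- **THEOREM XXIX(i), hypothesis-free, at every torsion order.** For every real algebraic
`0 < m < 1`, `q ≥ 1` and `0 < p < q`, with `σ = S_p(b)` the `p`-th node of the `q`-division chain
(model `σ = sn(pK/q | m)`, algebraic) and `ζ_j` its second-kind costs:
`Π(m σ² | m) = (1 + (p ζ_q − q ζ_p)/(q c_σ))·K(m)`, `c_σ = √((1−σ²)(1−mσ²))/σ` — an explicit
algebraic multiple. [this work] -/
theorem soloInformed_division_thirdKind_value {m : ℝ} (hm : m ∈ Ioo (0:ℝ) 1)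
    (hma : IsAlgebraic ℚ m) {q : ℕ} (hq : 1 ≤ q) {p : ℕ} (hp0 : 0 < p) (hpq : p < q)
    (PN K : IntegralRep 1) (hPNd : PN.domain = {x | x 0 ∈ Ioo (0:ℝ) 1})
    (hPNi : EqOn PN.integrand (fun x =>
      (1 - m * soloInformedIter m (soloInformedDivStep m q) p ^ 2 * x 0 ^ 2)⁻¹ *
        ((√(1 - x 0 ^ 2))⁻¹ * (√(1 - m * x 0 ^ 2))⁻¹)) PN.domain)
    (hKd : K.domain = {x | x 0 ∈ Ioo (0:ℝ) 1})
    (hKi : EqOn K.integrand (fun x => (√(1 - x 0 ^ 2))⁻¹ * (√(1 - m * x 0 ^ 2))⁻¹) K.domain) :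
    IsAlgebraic ℚ (soloInformedIter m (soloInformedDivStep m q) p) ∧
    PN.value = (1 + ((q : ℝ) * (√((1 - soloInformedIter m (soloInformedDivStep m q) p ^ 2) *
        (1 - m * soloInformedIter m (soloInformedDivStep m q) p ^ 2)) /
        soloInformedIter m (soloInformedDivStep m q) p))⁻¹ *
        ((p : ℝ) * (soloInformedDivChainOf hm hma hq).zeta q -
          (q : ℝ) * (soloInformedDivChainOf hm hma hq).zeta p)) * K.value :=
  ⟨(soloInformed_divChain_mem (soloInformedDivChainOf hm hma hq) hm hma p hpq.le).2,
    soloInformed_divChain_thirdKind_value (soloInformedDivChainOf hm hma hq) hm hma hp0 hpq PN K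
      hPNd hPNi hKd hKi⟩

end Summit.KontsevichZagierPeriods.KontsevichZagierPeriods.Theorems

end
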